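import Literature.Barriers.FinalStateConjecture.ExtremalHorizonAxisymmetricProjection
import Literature.Barriers.FinalStateConjecture.ExtremalHorizonAxisymmetricDecay
import HarnessLib

/-!
# Barrier catalogue `FinalStateConjecture`: the reduction of Aretakis's Theorem 3 to the conservation
# law and the decay/blow-up of axisymmetric solutions (`Literature/Barriers/FinalStateConjecture/`,
# D-0021, D-0014; family `gr`)

`ExtremalHorizonInstabilityProofs.lean` reduces the barrier `AretakisInstability` (Aretakis's
Theorem 3, ATMP 19 (2015), in existence form) to the chart-level Cauchy problem and to Theorem 3,
clauses `k = 1, 2`, in universal asymptotic form. This file is where that form of **Theorem 3 is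
stated and proved** (conditionally): the printed proof of Theorem 3 is the sentence "Combining the
methods of [aretakis2], the results of the present paper [the conservation laws] and [aretakis3] and
by projecting to the zeroth azimuthal frequency", and this file **proves**

`Aretakis2015.scalarInstability_of_facts :
    Aretakis2012_pointwiseDecay → (k = 2 blow-up for axisymmetric solutions) → (Theorem 3, k = 1, 2)`,

the conclusion — Theorem 3 as vendored, with its printed wording and the itemised deviations in the
docstring of the theorem — and the second hypothesis being spelled out verbatim. (Until the review
of 2026-08-15 under D-0026/D-0027 these two statements were the named facts
`Aretakis2015_scalarInstability` of `ExtremalHorizonInstabilityProofs.lean` and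
`Aretakis2015_axisymmetricBlowup` of `ExtremalHorizonAxisymmetricDecay.lean`; both were pass-through
nodes of the debt census — PROVED from the single leaf `Aretakis2012_pointwiseDecay` in
`ExtremalHorizonBlowupProofs.lean` — and were merged back into the obligation of the parent
`AretakisInstability`: the `def`s are gone and the theorems formerly named
`Aretakis2015_scalarInstability.of_facts`, `….of_decay`, `Aretakis2015_axisymmetricBlowup.of_decay`
— dotted names anchored at those `def`s — are `Aretakis2015.scalarInstability_of_facts` (this
file), `Aretakis2015.scalarInstability_of_decay` and `Aretakis2015.axisymmetricBlowup_of_decay`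
(`ExtremalHorizonBlowupProofs.lean`).) That is, Theorem 3 (as vendored) follows from
* the conservation of `H₀^{Kerr}` along `𝓗⁺` — PROVED (`Aretakis2015_chargeConservation_holds`,
  `ExtremalHorizonChargeConservationProofs.lean`);
* the pointwise decay of axisymmetric solutions (Aretakis, JFA 263 (2012), Thm. 5; named fact
  `Aretakis2012_pointwiseDecay`, `ExtremalHorizonAxisymmetricDecay.lean`), applied to the axisymmetric
  part `ψ₀` of the solution and to `Tψ₀ = ∂_{t*} ψ₀`;
* the `k = 2` blow-up clause for axisymmetric solutions (hypothesis `hBlow`, the special case of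
  the printed theorem to which its argument reduces it; it is the conclusion of the PROVED
  conditional theorem `Aretakis2015.axisymmetricBlowup_of_decay` of
  `ExtremalHorizonBlowupProofs.lean`, which derives it from `Aretakis2012_pointwiseDecay`, so that
  `Aretakis2015.scalarInstability_of_decay` there concludes Theorem 3 from the decay fact alone);
* the projection to the zeroth azimuthal frequency — PROVED (`ExtremalHorizonAxisymmetricProjection.lean`:
  the cutoff average `Kerr.rotAverage`, its smoothness, `□_g` of the average, localisation, axisymmetry,
  `H₀[ψ₀] = 2π H₀[ψ]`, `Yψ₀ = ∫ (Yψ) ∘ R_α`, `YYψ₀ = ∫ (YYψ) ∘ R_α`, and the closure of the class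
  under `T`).

The argument (Aretakis's Thm. 1 mechanism made quantitative): by conservation,
`H₀[ψ₀] = ∫_{S_τ} (M sin² θ Tψ₀ + 4M Yψ₀ + 2ψ₀)` for every `τ ≥ 0`; once `|ψ₀|, |Tψ₀| ≤ ε` on `S_τ`
(decay fact) with `8πM²(M + 2)ε = |H₀[ψ₀]|/4`, the assumption `|Yψ₀| < |H₀[ψ₀]|/(64πM³)` on all of
`S_τ` would give `|H₀[ψ₀]| < |H₀[ψ₀]|/4 + |H₀[ψ₀]|/2` (`Kerr.abs_sphereIntegral_le`), a contradiction;
and lower bounds at a point of `S_τ` for `|Yψ₀| = |∫(Yψ)∘R_α|`, `|YYψ₀| = |∫(YYψ)∘R_α|` transfer to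
`ψ` at a rotated point of the `R_α`-invariant sphere (`Kerr.exists_le_abs_of_le_abs_integral`). The
constant is `c = min(1/(64πM³), c₂)`, `c₂` the constant of the blow-up hypothesis.

## References

* S. Aretakis, *Horizon instability of extremal black holes*, Adv. Theor. Math. Phys. 19 (2015)
  507–530 (arXiv:1206.6598): Thm. 1 (non-decay mechanism), §5.2, Thm. 3 and the sentence before it
  (key `Aretakis2015`).
* S. Aretakis, *Decay of axisymmetric solutions of the wave equation on extreme Kerr backgrounds*,
  J. Funct. Anal. 263 (2012) 2770–2831, §3, Thm. 5 (key `Aretakis2012`).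
-/

noncomputable section

open Set Filter MeasureTheory intervalIntegral
open scoped Topology ContDiff Manifold

namespace Literature.Barriers.FinalStateConjecture.Kerr

open Literature.Geometry.Lorentzian

/-! ### Estimates on the sphere and the transfer of lower bounds along orbits -/

/-- **The sphere-integral estimate**: if `|D(θ, φ)| ≤ C sin θ` on `[0, π] × [0, 2π]` then
`|∫₀^{2π} ∫₀^π D dθ dφ| ≤ 4πC` (`∫₀^π sin = 2`). [folklore] -/
theorem abs_sphereIntegral_le {D : ℝ → ℝ → ℝ} {C : ℝ}
    (hD : ∀ θ ∈ Icc (0 : ℝ) Real.pi, ∀ φ ∈ Icc (0 : ℝ) (2 * Real.pi), |D θ φ| ≤ C * Real.sin θ) :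
    |∫ φ in (0 : ℝ)..2 * Real.pi, ∫ θ in (0 : ℝ)..Real.pi, D θ φ| ≤ 4 * Real.pi * C := by
  have hπ : (0 : ℝ) ≤ Real.pi := Real.pi_pos.le
  have hinner : ∀ φ ∈ Icc (0 : ℝ) (2 * Real.pi), |∫ θ in (0 : ℝ)..Real.pi, D θ φ| ≤ 2 * C := by
    intro φ hφ
    have h := intervalIntegral.norm_integral_le_of_norm_le (f := fun θ ↦ D θ φ)
      (g := fun θ ↦ C * Real.sin θ) (μ := volume) hπ
      (Eventually.of_forall fun θ hθ ↦ by
        rw [Real.norm_eq_abs]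
        exact hD θ ⟨hθ.1.le, hθ.2⟩ φ hφ)
      ((continuous_const.mul Real.continuous_sin).intervalIntegrable _ _)
    rw [intervalIntegral.integral_const_mul, integral_sin, Real.cos_zero, Real.cos_pi] at h
    rw [← Real.norm_eq_abs]
    linarith
  have h := intervalIntegral.norm_integral_le_of_norm_le_const (a := 0) (b := 2 * Real.pi)
    (f := fun φ ↦ ∫ θ in (0 : ℝ)..Real.pi, D θ φ) (C := 2 * C) fun φ hφ ↦ by
      rw [uIoc_of_le (by positivity)] at hφ
      rw [Real.norm_eq_abs]
      exact hinner φ ⟨hφ.1.le, hφ.2⟩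
  rw [Real.norm_eq_abs, sub_zero, abs_of_pos Real.two_pi_pos] at h
  linarith

/-- **Strict bound for the period integral of a continuous function strictly bounded on the
period**: `|f| < m` on `[0, 2π]` ⇒ `|∫₀^{2π} f| < 2πm` (the maximum of `|f|` is attained).
[folklore] -/
theorem abs_integral_lt_of_forall_abs_lt {f : ℝ → ℝ} (hf : Continuous f) {m : ℝ}
    (h : ∀ α ∈ Icc (0 : ℝ) (2 * Real.pi), |f α| < m) :
    |∫ α in (0 : ℝ)..2 * Real.pi, f α| < 2 * Real.pi * m := by
  have h2π : (0 : ℝ) < 2 * Real.pi := Real.two_pi_pos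
  obtain ⟨α₀, hα₀, hmax⟩ := (isCompact_Icc (a := (0 : ℝ)) (b := 2 * Real.pi)).exists_isMaxOn
    (nonempty_Icc.mpr h2π.le) (hf.abs.continuousOn)
  have hb := intervalIntegral.norm_integral_le_of_norm_le_const (a := 0) (b := 2 * Real.pi)
    (f := f) (C := |f α₀|) fun α hα ↦ by
      rw [uIoc_of_le h2π.le] at hα
      rw [Real.norm_eq_abs]
      exact hmax ⟨hα.1.le, hα.2⟩
  rw [Real.norm_eq_abs, sub_zero, abs_of_pos h2π] at hb
  have hlt := h α₀ hα₀
  nlinarith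

/-- **Transfer of a lower bound along an orbit**: if `2π b ≤ |∫₀^{2π} f|` with `f` continuous, some
`α ∈ [0, 2π]` has `b ≤ |f α|`. [folklore] -/
theorem exists_le_abs_of_le_abs_integral {f : ℝ → ℝ} (hf : Continuous f) {b : ℝ}
    (h : 2 * Real.pi * b ≤ |∫ α in (0 : ℝ)..2 * Real.pi, f α|) :
    ∃ α ∈ Icc (0 : ℝ) (2 * Real.pi), b ≤ |f α| := by
  by_contra hcon
  simp only [not_exists, not_and, not_le] at hcon
  have hlt := abs_integral_lt_of_forall_abs_lt hf hcon
  linarith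

/-! ### Auxiliary identifications for the assembly -/

/-- The density of `densityFun` depends only on the values and first derivatives of the function
near the horizon point: two functions agreeing on an open set containing it have the same density.
[folklore] -/
theorem densityFun_congr {M : ℝ} {Ψ₁ Ψ₂ : E4 → ℝ} {O : Set E4} (hO : IsOpen O) (h : EqOn Ψ₁ Ψ₂ O)
    {σ θ φ : ℝ} (hp : horizonPoint M σ θ φ ∈ O) :
    densityFun M Ψ₁ σ θ φ = densityFun M Ψ₂ σ θ φ := by
  simp only [densityFun, h hp, fderiv_eq_of_eqOn_isOpen hO h hp]

/-- The representative `extend f 0` of a chart function `y ↦ Φ(y)` agrees with `Φ` on the chart.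
[folklore] -/
theorem eqOn_extend_rep {a r₀ : ℝ} (Φ : E4 → ℝ) :
    EqOn (Function.extend Subtype.val (fun y : Kerr.region a r₀ ↦ Φ y) 0) Φ (Kerr.region a r₀ : Set E4) :=
  fun z hz ↦ (Kerr.extend_apply_coe (fun y : Kerr.region a r₀ ↦ Φ y) ⟨z, hz⟩).symm

/-- The charge on `S_τ` of a chart function with a global representative `Φ` is the sphere
integral of `densityFun M Φ τ` (for `0 < M`, `r₀ < M`, so that the horizon points lie in the chart).
[cite: Aretakis2015, §5.2] -/
theorem aretakisChargeAt_of_rep {M r₀ : ℝ} (hM : 0 < M) (hr₀ : r₀ < M) (Φ : E4 → ℝ) (τ : ℝ) :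
    aretakisChargeAt M r₀ (fun y : Kerr.region M r₀ ↦ Φ y) τ =
      ∫ φ in (0 : ℝ)..2 * Real.pi, ∫ θ in (0 : ℝ)..Real.pi, densityFun M Φ τ θ φ := by
  unfold aretakisChargeAt
  refine intervalIntegral.integral_congr fun φ _ ↦ intervalIntegral.integral_congr fun θ _ ↦ ?_
  rw [aretakisChargeDensityAt_eq_densityFun]
  exact densityFun_congr (Kerr.region M r₀).isOpen (eqOn_extend_rep Φ) (horizonPoint_mem_region hM hr₀ τ θ φ)

/-- The initial charge of a chart function with a global representative. [cite: Aretakis2015, §5.2] -/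
theorem aretakisCharge_of_rep {M r₀ : ℝ} (hM : 0 < M) (hr₀ : r₀ < M) (Φ : E4 → ℝ) :
    aretakisCharge M r₀ (fun y : Kerr.region M r₀ ↦ Φ y) =
      ∫ φ in (0 : ℝ)..2 * Real.pi, ∫ θ in (0 : ℝ)..Real.pi, densityFun M Φ 0 θ φ := by
  rw [← aretakisChargeAt_zero, aretakisChargeAt_of_rep hM hr₀]

/-- The initial charge of any chart function as the sphere integral of the density of its
representative. [cite: Aretakis2015, §5.2] -/
theorem aretakisCharge_eq_sphereIntegral_densityFun {M r₀ : ℝ} (ψ : Kerr.region M r₀ → ℝ) :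
    aretakisCharge M r₀ ψ = ∫ φ in (0 : ℝ)..2 * Real.pi, ∫ θ in (0 : ℝ)..Real.pi,
      densityFun M (Function.extend Subtype.val ψ 0) 0 θ φ := by
  rw [← aretakisChargeAt_zero]
  rfl

/-- **The second transversal derivative of `ψ` near `U` in terms of a cutoff representative.**
With `EqOn G (extend ψ 0) N`, `N` open over `U`: for `z ∈ N`,
`YYψ(z) = D[w ↦ DG(w)(ℓ♯_w)](z)(ℓ♯_z)`. [folklore] -/
theorem transversalDeriv_transversalDeriv_eq_of_cutoff {M r₀ : ℝ} {U : Set (Kerr.region M r₀)}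
    {ψ : Kerr.region M r₀ → ℝ} (hU : IsOpen U) (hψ : ContMDiffOn 𝓘(ℝ, E4) 𝓘(ℝ, ℝ) ∞ ψ U)
    {G : E4 → ℝ} {N : Set E4} (hN : IsOpen N)
    (hNU : ∀ z ∈ N, ∃ hz : z ∈ Kerr.region M r₀, (⟨z, hz⟩ : Kerr.region M r₀) ∈ U)
    (hGN : EqOn G (Function.extend Subtype.val ψ 0) N) {z : E4} (hz : z ∈ N) :
    ∃ hz' : z ∈ Kerr.region M r₀,
      transversalDeriv M r₀ (transversalDeriv M r₀ ψ) ⟨z, hz'⟩ =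
        fderiv ℝ (fun w ↦ fderiv ℝ G w (Kerr.nullVector M w)) z (Kerr.nullVector M z) := by
  obtain ⟨hz', hzU⟩ := hNU z hz
  refine ⟨hz', ?_⟩
  set YG : E4 → ℝ := fun w ↦ fderiv ℝ G w (Kerr.nullVector M w) with hYG
  obtain ⟨hYψ, hYval⟩ := contMDiffOn_transversalDeriv hU hψ
  -- `extend (Yψ) 0 = YG` on `N`
  have hGN' : EqOn YG (Function.extend Subtype.val (transversalDeriv M r₀ ψ) 0) N := by
    intro w hw
    obtain ⟨hw', hwU⟩ := hNU w hw
    rw [← Kerr.extend_apply_coe (transversalDeriv M r₀ ψ) ⟨w, hw'⟩, hYval _ hwU]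
    show fderiv ℝ G w (Kerr.nullVector M w) = _
    rw [fderiv_eq_of_eqOn_isOpen hN hGN hw]
  obtain ⟨-, hYYval⟩ := contMDiffOn_transversalDeriv hU hYψ
  rw [hYYval _ hzU]
  show fderiv ℝ (Function.extend Subtype.val (transversalDeriv M r₀ ψ) 0) z (Kerr.nullVector M z) = _
  rw [← fderiv_eq_of_eqOn_isOpen hN hGN' hz]

/-- The first transversal derivative near `U` in terms of the cutoff representative:
for `z ∈ N`, `Yψ(z) = DG(z)(ℓ♯_z)`. [folklore] -/
theorem transversalDeriv_eq_of_cutoff {M r₀ : ℝ} {U : Set (Kerr.region M r₀)}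
    {ψ : Kerr.region M r₀ → ℝ} (hU : IsOpen U) (hψ : ContMDiffOn 𝓘(ℝ, E4) 𝓘(ℝ, ℝ) ∞ ψ U)
    {G : E4 → ℝ} {N : Set E4} (hN : IsOpen N)
    (hNU : ∀ z ∈ N, ∃ hz : z ∈ Kerr.region M r₀, (⟨z, hz⟩ : Kerr.region M r₀) ∈ U)
    (hGN : EqOn G (Function.extend Subtype.val ψ 0) N) {z : E4} (hz : z ∈ N) :
    ∃ hz' : z ∈ Kerr.region M r₀,
      transversalDeriv M r₀ ψ ⟨z, hz'⟩ = fderiv ℝ G z (Kerr.nullVector M z) := by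
  obtain ⟨hz', hzU⟩ := hNU z hz
  obtain ⟨-, hYval⟩ := contMDiffOn_transversalDeriv hU hψ
  refine ⟨hz', ?_⟩
  rw [hYval _ hzU]
  show fderiv ℝ (Function.extend Subtype.val ψ 0) z (Kerr.nullVector M z) = _
  rw [fderiv_eq_of_eqOn_isOpen hN hGN hz]

/-- **Pointwise bound for the charge density on a sphere** from bounds on `Ψ`, `TΨ`, `YΨ` at the
horizon point (`sin² θ ≤ 1`, `sin θ ≥ 0` on `[0, π]`). [folklore] -/
theorem abs_densityFun_le {M : ℝ} (hM : 0 < M) {Ψ : E4 → ℝ} {σ θ φ ε m : ℝ}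
    (hθ : θ ∈ Icc (0 : ℝ) Real.pi) (h0 : |Ψ (horizonPoint M σ θ φ)| ≤ ε)
    (hT : |fderiv ℝ Ψ (horizonPoint M σ θ φ) (E4.basisVector 0)| ≤ ε)
    (hY : |fderiv ℝ Ψ (horizonPoint M σ θ φ) (Kerr.nullVector M (horizonPoint M σ θ φ))| ≤ m) :
    |densityFun M Ψ σ θ φ| ≤ (2 * M ^ 2 * ((M + 2) * ε + 4 * M * m)) * Real.sin θ := by
  have hs : 0 ≤ Real.sin θ := Real.sin_nonneg_of_nonneg_of_le_pi hθ.1 hθ.2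
  have hs1 : Real.sin θ ^ 2 ≤ 1 := Real.sin_sq_le_one θ
  have hε : 0 ≤ ε := (abs_nonneg _).trans h0
  have hm : 0 ≤ m := (abs_nonneg _).trans hY
  set a := fderiv ℝ Ψ (horizonPoint M σ θ φ) (E4.basisVector 0) with ha
  set b := fderiv ℝ Ψ (horizonPoint M σ θ φ) (Kerr.nullVector M (horizonPoint M σ θ φ)) with hb
  set c := Ψ (horizonPoint M σ θ φ) with hc
  have h1 : |M * Real.sin θ ^ 2 * a| ≤ M * ε := by
    rw [abs_mul, abs_mul, abs_of_pos hM, abs_of_nonneg (sq_nonneg _)]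
    calc M * Real.sin θ ^ 2 * |a| ≤ M * 1 * ε := by gcongr
      _ = M * ε := by ring
  have h2 : |4 * M * b| ≤ 4 * M * m := by
    rw [abs_mul, abs_of_pos (by positivity : (0 : ℝ) < 4 * M)]
    gcongr
  have h3 : |2 * c| ≤ 2 * ε := by
    rw [abs_mul, abs_two]
    linarith
  have htri : |M * Real.sin θ ^ 2 * a + 4 * M * b + 2 * c| ≤ M * ε + 4 * M * m + 2 * ε :=
    (abs_add_le _ _).trans (add_le_add ((abs_add_le _ _).trans (add_le_add h1 h2)) h3)
  rw [densityFun, ← ha, ← hb, ← hc, abs_mul,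
    abs_of_nonneg (by positivity : (0 : ℝ) ≤ 2 * M ^ 2 * Real.sin θ)]
  calc |M * Real.sin θ ^ 2 * a + 4 * M * b + 2 * c| * (2 * M ^ 2 * Real.sin θ)
      ≤ (M * ε + 4 * M * m + 2 * ε) * (2 * M ^ 2 * Real.sin θ) := by gcongr
    _ = (2 * M ^ 2 * ((M + 2) * ε + 4 * M * m)) * Real.sin θ := by ring

/-- **The `t*`-derivative of an axisymmetric smooth function is axisymmetric** (`R_α ∂_{t*} = ∂_{t*}`).
[folklore] -/
theorem fderiv_basisVector_zero_axialRotation {Φ : E4 → ℝ} (hΦ : Differentiable ℝ Φ)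
    (h : ∀ β x, Φ (E4.axialRotation β x) = Φ x) (β : ℝ) (x : E4) :
    fderiv ℝ Φ (E4.axialRotation β x) (E4.basisVector 0) = fderiv ℝ Φ x (E4.basisVector 0) := by
  have hfun : Φ ∘ (E4.axialRotation β) = Φ := funext fun x ↦ h β x
  have hc := fderiv_comp x (hΦ (E4.axialRotation β x)) (E4.axialRotation β).differentiableAt
  rw [hfun, (E4.axialRotation β).fderiv] at hc
  have := congrArg (fun L : E4 →L[ℝ] ℝ ↦ L (E4.basisVector 0)) hc
  simpa using this.symm

end Literature.Barriers.FinalStateConjecture.Kerr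

namespace Literature.Barriers.FinalStateConjecture

open Literature.Geometry.Lorentzian

/-! ### The reduction of Theorem 3 to the conservation law and the two analytic facts -/

/-- **Aretakis's scalar instability of extremal Kerr — Theorem 3, clauses `k = 1, 2`, in universal
asymptotic form (the statement as vendored in this library), proved from the decay of axisymmetric
solutions and the `k = 2` blow-up for axisymmetric solutions.**
Printed statement (Aretakis, ATMP 19 (2015), Thm. 3, p. 12): "There exists a constant `c > 0` which
depends only on `M` such that for all solutions to the wave equation on extremal Kerr we have
• Non-decay: `sup_{S_τ} |Yψ| ≥ c |H₀[ψ]|` along `𝓗⁺`, and `H₀[ψ]` is a constant which depends only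
on the initial data and is generically non-zero. • Pointwise blow-up:
`sup_{S_τ} |Y^k ψ| ≥ c |H₀[ψ]| τ^{k−1}` asymptotically along `𝓗⁺` for all `k ≥ 2`. • Energy blow-up
[...]", obtained by "combining the methods of [aretakis2], the results of the present paper [the
conservation of `H₀^{Kerr}`, Prop. 5.1] and [aretakis3] [decay of axisymmetric solutions arising
from regular data: Aretakis, JFA 263 (2012), quoted as items 1–2 of §5.2] and by projecting to the
zeroth azimuthal frequency"; here `Y = ∂_r`, `T = ∂_v` in ingoing coordinates `(v, r, θ, φ*)` and
`S_τ` are the sections of `𝓗⁺ = {r = M}` (§5.2).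
**Vendored form (the conclusion).** For `M > 0` and `0 < r₀ < M` there is `c > 0` such that for
every `ψ` of class `C^∞` on an open set `U ⊇ {r ≥ r₊ = M} ∩ {t* ≥ 0}` of the chart `Kerr.region M r₀`
of extremal Kerr `g_{M,M}` (`Kerr.smoothMetric M M r₀`, `[Kerr.Facts] [Kerr.SliceFacts]` as in
gr.S24), solving `□_g ψ = 0` on `U`, whose Cauchy data on the leaf `{t* = 0}` are supported in a
coordinate ball (`ψ = 0` and `dψ = 0` at the points of `U ∩ {t* = 0}` with `‖x⃗‖ > ρ`): if
`H₀[ψ] ≠ 0` (`aretakisCharge`), then there is `τ₁` such that every horizon sphere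
`S_τ = {r = M} ∩ {t* = τ}`, `τ ≥ τ₁`, carries a point with `|Yψ| ≥ c|H₀[ψ]|` and a point with
`|YYψ| ≥ c|H₀[ψ]| τ` (`Y = Kerr.transversalDeriv`, `S_τ = Kerr.horizonSection`; on `𝓗⁺`,
`t* = v − M`). Until the review of 2026-08-15 this conclusion was the body of the named fact
`Aretakis2015_scalarInstability` (`ExtremalHorizonInstabilityProofs.lean`), audited faithful against
the held copy (arXiv:1206.6598, p. 12) on 2026-08-15; it is repeated verbatim as the conclusion of
`Aretakis2015.scalarInstability_of_decay` (`ExtremalHorizonBlowupProofs.lean`) and as the hypothesis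
`hA` of `AretakisInstability.of_facts` / `AretakisInstability.of_kerrSchild`.
**Deviations from the printed wording, all weakenings or identifications.** (a) Both clauses are
asymptotic (`τ ≥ τ₁(ψ)`), as the word "asymptotically" and the mechanism (`4M ∫_{S_τ} Yψ → H₀` as
`ψ, Tψ → 0` along `𝓗⁺`) indicate; read for *every* `τ` the non-decay inequality is false (data `≡ 1`
near `S₀`: `Yψ = Tψ = 0` on `S₀`, `H₀ = 2|S₀|`). (b) `sup_{S_τ}` over the compact sphere is
attained (`ψ` is `C^∞`), whence "carries a point". (c) "All solutions to the wave equation on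
extremal Kerr" are the solutions on `D⁺(Σ₀)` arising from regular data on a hypersurface `Σ₀`
crossing `𝓗⁺` (§2.2, §5.2 items 1–2); for `U`, `ψ` as above, the set `{r ≥ M} ∩ {t* ≥ 0}` lies in
the Cauchy development, taken inside the spacetime `U`, of the piece `A = U ∩ {t* = 0}` of the leaf
(the chart is ingoing: `𝓗⁺ = {r = M}` is a null hypersurface crossed by future causal curves only
inwards, causal vectors have coordinate speed `≤ 1` as `H ≥ 0`, and `t*` is a time function,
Dafermos–Rodnianski arXiv:0811.0354, §5.1, so a past-directed causal curve from that set stays in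
the compact set `{r ≥ M} ∩ {0 ≤ t* ≤ t*₀} ∩ {‖x⃗ − x⃗₀‖ ≤ t*₀} ⊆ U` until it meets `A`), which is
open and globally hyperbolic with Cauchy hypersurface `A` (O'Neill 1983, Ch. 14, Thm. 38 and
Lemma 43); so by uniqueness for the Cauchy problem (Bär–Ginoux–Pfäffle 2007, Cor. 3.2.4) `ψ`
coincides there, with all its derivatives on `𝓗⁺`, with the solution (Thm. 3.2.11 ibid.) arising
from any smooth compactly supported extension of its (smooth, compactly supported) data on
`A ∩ {r ≥ M}` to such a `Σ₀`. (d) Only `k = 1, 2`; the energy clause is not vendored; `c` may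
depend on `r₀` as well; `H₀` is normalised with the induced area element (see `aretakisCharge`).
**Hypotheses.** `hDec`: the decay of axisymmetric solutions (Aretakis 2012, Thm. 5; named fact
`Aretakis2012_pointwiseDecay`). `hBlow`: the `k = 2` clause above restricted to **axisymmetric**
solutions (`Kerr.IsAxisymmetric ψ`) — the case to which the printed argument reduces the theorem and
in which the decay input [aretakis3] applies — spelled out verbatim; it is the conclusion of
`Aretakis2015.axisymmetricBlowup_of_decay` (`ExtremalHorizonBlowupProofs.lean`, proved from `hDec`;
until the review of 2026-08-15 the named fact `Aretakis2015_axisymmetricBlowup`). The conservation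
law is proved (`Aretakis2015_chargeConservation_holds`).
**Proof** ("projecting to the zeroth azimuthal frequency", Aretakis 2015, before Thm. 3): given a
solution `ψ` of the class with `H₀[ψ] ≠ 0`, average it over the axial rotations with a smooth cutoff
(`Kerr.rotAverage`): the average `ψ₀` is a smooth axisymmetric solution on a rotation-invariant open
set `⊇ {r ≥ M} ∩ {t* ≥ 0}` with localised data and `H₀[ψ₀] = 2π H₀[ψ]`, and so is `Tψ₀ = ∂_{t*}ψ₀`.
By the decay fact `ψ₀, Tψ₀ → 0` uniformly on the horizon spheres `S_τ`; by conservation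
`H₀[ψ₀] = ∫_{S_τ}(M sin²θ Tψ₀ + 4M Yψ₀ + 2ψ₀)`, whence for late `τ` some point of `S_τ` has
`|Yψ₀| ≥ |H₀[ψ₀]|/(64πM³)`; the blow-up hypothesis gives a point with `|YYψ₀| ≥ c₂|H₀[ψ₀]|τ`; since
`Yψ₀ = ∫(Yψ)∘R_α`, `YYψ₀ = ∫(YYψ)∘R_α` and `S_τ` is `R_α`-invariant, the bounds transfer to `ψ` with
the constant `c = min(1/(64πM³), c₂)`.
[cite: Aretakis2015, Thm. 3 (p. 12), Prop. 5.1 and §5.2; Aretakis2012, Thm. 5; BarGinouxPfaffle2007, Thm. 3.2.11 and Cor. 3.2.4; ONeill1983, Ch. 14 Thm. 38, Lemma 43; arXiv08110354, §5.1] -/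
theorem Aretakis2015.scalarInstability_of_facts (hDec : Aretakis2012_pointwiseDecay)
    (hBlow :
      ∀ [Kerr.Facts] [Kerr.SliceFacts] (M : ℝ), 0 < M → ∀ r₀ ∈ Set.Ioo 0 M,
        ∃ c > (0 : ℝ), ∀ (U : Set (Kerr.region M r₀)) (ψ : Kerr.region M r₀ → ℝ),
          IsOpen U →
          {x : Kerr.region M r₀ | Kerr.rPlus M M ≤ Kerr.radius M (x : E4) ∧ 0 ≤ (x : E4) 0} ⊆ U →
          ContMDiffOn 𝓘(ℝ, E4) 𝓘(ℝ, ℝ) ∞ ψ U →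
          (∀ x ∈ U, (Kerr.smoothMetric M M r₀).toPseudoRiemannianMetric.dalembertian ψ x = 0) →
          (∃ ρ : ℝ, ∀ x ∈ U, (x : E4) 0 = 0 → ρ < E4.spatialNorm (x : E4) →
            ψ x = 0 ∧ mfderiv 𝓘(ℝ, E4) 𝓘(ℝ, ℝ) ψ x = 0) →
          Kerr.IsAxisymmetric ψ →
          aretakisCharge M r₀ ψ ≠ 0 →
          ∃ τ₁ : ℝ, ∀ τ : ℝ, τ₁ ≤ τ →
            ∃ x ∈ Kerr.horizonSection M M r₀ τ,
              c * |aretakisCharge M r₀ ψ| * τ ≤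
                |Kerr.transversalDeriv M r₀ (Kerr.transversalDeriv M r₀ ψ) x|) :
    ∀ [Kerr.Facts] [Kerr.SliceFacts] (M : ℝ), 0 < M → ∀ r₀ ∈ Set.Ioo 0 M,
      ∃ c > (0 : ℝ), ∀ (U : Set (Kerr.region M r₀)) (ψ : Kerr.region M r₀ → ℝ),
        IsOpen U →
        {x : Kerr.region M r₀ | Kerr.rPlus M M ≤ Kerr.radius M (x : E4) ∧ 0 ≤ (x : E4) 0} ⊆ U →
        ContMDiffOn 𝓘(ℝ, E4) 𝓘(ℝ, ℝ) ∞ ψ U →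
        (∀ x ∈ U, (Kerr.smoothMetric M M r₀).toPseudoRiemannianMetric.dalembertian ψ x = 0) →
        (∃ ρ : ℝ, ∀ x ∈ U, (x : E4) 0 = 0 → ρ < E4.spatialNorm (x : E4) →
          ψ x = 0 ∧ mfderiv 𝓘(ℝ, E4) 𝓘(ℝ, ℝ) ψ x = 0) →
        aretakisCharge M r₀ ψ ≠ 0 →
        ∃ τ₁ : ℝ, ∀ τ : ℝ, τ₁ ≤ τ →
          (∃ x ∈ Kerr.horizonSection M M r₀ τ,
            c * |aretakisCharge M r₀ ψ| ≤ |Kerr.transversalDeriv M r₀ ψ x|) ∧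
          (∃ x ∈ Kerr.horizonSection M M r₀ τ,
            c * |aretakisCharge M r₀ ψ| * τ ≤
              |Kerr.transversalDeriv M r₀ (Kerr.transversalDeriv M r₀ ψ) x|) := by
  intro _ _ M hM r₀ hr₀
  obtain ⟨hr₀pos, hr₀M⟩ := hr₀
  obtain ⟨c₂, hc₂, hB⟩ := hBlow M hM r₀ ⟨hr₀pos, hr₀M⟩
  have hπ := Real.pi_pos
  set c₁ : ℝ := 1 / (64 * Real.pi * M ^ 3) with hc₁def
  have hc₁ : 0 < c₁ := by positivity
  refine ⟨min c₁ c₂, lt_min hc₁ hc₂, ?_⟩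
  intro U ψ hU hKU hψ hsol hloc hH
  obtain ⟨ρ, hρ⟩ := hloc
  /- Step 1: the representative, the open set over `U`, the cutoff -/
  set Ψ : E4 → ℝ := Function.extend Subtype.val ψ 0 with hΨdef
  have hrep : ∀ y : Kerr.region M r₀, ψ y = Ψ y := Kerr.extend_apply_coe ψ
  set V : Set E4 := Subtype.val '' U with hVdef
  have hV : IsOpen V := (Kerr.region M r₀).isOpen.isOpenMap_subtype_val U hU
  have hΨV : ∀ x ∈ V, ContDiffAt ℝ ∞ Ψ x := by
    rintro x ⟨y, hyU, rfl⟩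
    exact (OpensChart.contMDiffAt_iff y ψ Ψ hrep).mp (hψ.contMDiffAt (hU.mem_nhds hyU))
  have hVpos : ∀ z ∈ V, 0 < Kerr.radius M z := by
    rintro _ ⟨y, _, rfl⟩; exact Kerr.radius_pos_of_mem_region y.2
  set K' : Set E4 := {x : E4 | Kerr.rPlus M M ≤ Kerr.radius M x ∧ 0 ≤ x 0} with hK'def
  have hK'c : IsClosed K' := Kerr.isClosed_horizonFutureSet M M
  have hK'reg : ∀ x ∈ K', x ∈ Kerr.region M r₀ := by
    intro x hx
    rw [Kerr.mem_region]
    have h1 : Kerr.rPlus M M ≤ Kerr.radius M x := hx.1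
    rw [Kerr.rPlus_self] at h1
    exact max_lt (by linarith) (by linarith)
  have hK'V : K' ⊆ V := fun x hx ↦ ⟨⟨x, hK'reg x hx⟩, hKU hx, rfl⟩
  obtain ⟨χ, N, hχ, hN, hKN, hNV, hχ1, hχsupp⟩ := Kerr.exists_smooth_cutoff hK'c hV hK'V
  set G : E4 → ℝ := fun z ↦ χ z * Ψ z with hGdef
  have hG : ContDiff ℝ ∞ G := Kerr.contDiff_cutoff_mul hχ hχsupp hΨV
  have hGN : EqOn G Ψ N := fun z hz ↦ by
    show χ z * Ψ z = Ψ z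
    rw [hχ1 z hz, one_mul]
  have hNU : ∀ z ∈ N, ∃ hz : z ∈ Kerr.region M r₀, (⟨z, hz⟩ : Kerr.region M r₀) ∈ U := by
    intro z hz
    obtain ⟨y, hyU, hyz⟩ := hNV hz
    subst hyz
    exact ⟨y.2, hyU⟩
  have hGsupp : tsupport G ⊆ V := by
    refine (closure_mono fun z hz ↦ ?_).trans hχsupp
    intro h0
    exact hz (by simp [hGdef, h0])
  /- the rotation-invariant open set `U₀ ⊆ U` containing `K` -/
  set U₀ : Set (Kerr.region M r₀) := {x | ∀ α : ℝ, E4.axialRotation α x ∈ N} with hU₀def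
  have hU₀ : IsOpen U₀ :=
    (Kerr.isOpen_setOf_forall_axialRotation_mem hN).preimage continuous_subtype_val
  have hKU₀ : {x : Kerr.region M r₀ | Kerr.rPlus M M ≤ Kerr.radius M (x : E4) ∧ 0 ≤ (x : E4) 0} ⊆ U₀ := by
    intro x hx α
    exact hKN (Kerr.axialRotation_mem_horizonFutureSet_iff.mpr hx)
  have hU₀U : U₀ ⊆ U := by
    intro x hx
    obtain ⟨hz, hzU⟩ := hNU _ (by simpa using hx 0)
    exact hzU
  have hU₀N : ∀ x ∈ U₀, ∀ α, E4.axialRotation α (x : E4) ∈ N := fun x hx ↦ hx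
  /- Step 2: the averaged solution `ψ₀` -/
  set Ψ₀ : E4 → ℝ := Kerr.rotAverage G with hΨ₀def
  have hΨ₀ : ContDiff ℝ ∞ Ψ₀ := Kerr.contDiff_rotAverage hG
  set ψ₀ : Kerr.region M r₀ → ℝ := fun y ↦ Ψ₀ y with hψ₀def
  have hψ₀ : ContMDiffOn 𝓘(ℝ, E4) 𝓘(ℝ, ℝ) ∞ ψ₀ U₀ := fun y _ ↦
    ((OpensChart.contMDiffAt_iff y ψ₀ Ψ₀ (fun _ ↦ rfl)).mpr hΨ₀.contDiffAt).contMDiffWithinAt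
  have hsol₀ : ∀ x ∈ U₀, (Kerr.smoothMetric M M r₀).toPseudoRiemannianMetric.dalembertian ψ₀ x = 0 :=
    fun x hx ↦ Kerr.dalembertian_rotAverage_eq_zero hU hψ hsol hG hN hNU hGN x (hU₀N x hx)
  -- localisation of `ψ₀` (and of `Ψ₀` with its `fderiv`)
  have hloc₀' : ∀ x ∈ U₀, (x : E4) 0 = 0 → ρ < E4.spatialNorm (x : E4) →
      Ψ₀ x = 0 ∧ fderiv ℝ Ψ₀ x = 0 := by
    intro x hx hx0 hxρ
    have hzero : ∀ α, Ψ (E4.axialRotation α x) = 0 ∧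
        fderiv ℝ Ψ (E4.axialRotation α x) = 0 := by
      intro α
      obtain ⟨hz, hzU⟩ := hNU _ (hU₀N x hx α)
      have h := hρ ⟨_, hz⟩ hzU (by simp [hx0]) (by simpa [E4.spatialNorm_axialRotation] using hxρ)
      have hd : DifferentiableAt ℝ Ψ (E4.axialRotation α x) :=
        ((OpensChart.contMDiffAt_iff ⟨_, hz⟩ ψ Ψ hrep).mp (hψ.contMDiffAt (hU.mem_nhds hzU))).differentiableAt
          (WithTop.coe_ne_zero.mpr ENat.top_ne_zero)
      refine ⟨by rw [← hrep ⟨_, hz⟩]; exact h.1, ?_⟩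
      rw [← OpensChart.mfderiv_eq ⟨_, hz⟩ ψ Ψ hrep hd]
      exact h.2
    have hz1 : ∀ α, Ψ (E4.axialRotation α x) = 0 := fun α ↦ (hzero α).1
    have hz2 : ∀ α, fderiv ℝ Ψ (E4.axialRotation α x) = 0 := fun α ↦ (hzero α).2
    constructor
    · show Kerr.rotAverage G x = 0
      rw [Kerr.rotAverage_apply_of_forall_mem hGN (hU₀N x hx)]
      simp only [hz1, intervalIntegral.integral_zero]
    · ext v
      rw [Kerr.fderiv_rotAverage_apply_of_forall_mem hG hN hGN (hU₀N x hx)]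
      simp only [hz2, _root_.zero_apply, intervalIntegral.integral_zero]
  have hloc₀ : ∃ ρ' : ℝ, ∀ x ∈ U₀, (x : E4) 0 = 0 → ρ' < E4.spatialNorm (x : E4) →
      ψ₀ x = 0 ∧ mfderiv 𝓘(ℝ, E4) 𝓘(ℝ, ℝ) ψ₀ x = 0 := by
    refine ⟨ρ, fun x hx hx0 hxρ ↦ ⟨(hloc₀' x hx hx0 hxρ).1, ?_⟩⟩
    rw [OpensChart.mfderiv_eq x ψ₀ Ψ₀ (fun _ ↦ rfl) (hΨ₀.differentiable
      (WithTop.coe_ne_zero.mpr ENat.top_ne_zero) _)]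
    exact (hloc₀' x hx hx0 hxρ).2
  have haxi₀ : Kerr.IsAxisymmetric ψ₀ := fun α x ↦ Kerr.rotAverage_axialRotation G α x
  /- Step 3: the `t*`-derivative `Tψ₀` -/
  set TΨ₀ : E4 → ℝ := fun z ↦ fderiv ℝ Ψ₀ z (E4.basisVector 0) with hTΨ₀def
  have hTΨ₀ : ContDiff ℝ ∞ TΨ₀ := (hΨ₀.fderiv_right (m := ∞) le_rfl).clm_apply contDiff_const
  set Tψ₀ : Kerr.region M r₀ → ℝ := fun y ↦ TΨ₀ y with hTψ₀def
  have hTψ₀ : ContMDiffOn 𝓘(ℝ, E4) 𝓘(ℝ, ℝ) ∞ Tψ₀ U₀ := fun y _ ↦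
    ((OpensChart.contMDiffAt_iff y Tψ₀ TΨ₀ (fun _ ↦ rfl)).mpr hTΨ₀.contDiffAt).contMDiffWithinAt
  have hsolT : ∀ x ∈ U₀, (Kerr.smoothMetric M M r₀).toPseudoRiemannianMetric.dalembertian Tψ₀ x = 0 :=
    fun x hx ↦ Kerr.dalembertian_timeDeriv_eq_zero hΨ₀ hU₀ hsol₀ x hx
  have hlocT : ∃ ρ' : ℝ, ∀ x ∈ U₀, (x : E4) 0 = 0 → ρ' < E4.spatialNorm (x : E4) →
      Tψ₀ x = 0 ∧ mfderiv 𝓘(ℝ, E4) 𝓘(ℝ, ℝ) Tψ₀ x = 0 := by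
    refine ⟨ρ, fun x hx hx0 hxρ ↦ ?_⟩
    obtain ⟨h1, h2⟩ := Kerr.timeDeriv_localised hM.le hΨ₀ hU₀ hsol₀ hloc₀' x hx hx0 hxρ
    refine ⟨h1, ?_⟩
    rw [OpensChart.mfderiv_eq x Tψ₀ TΨ₀ (fun _ ↦ rfl) (hTΨ₀.differentiable
      (WithTop.coe_ne_zero.mpr ENat.top_ne_zero) _)]
    exact h2
  have haxiT : Kerr.IsAxisymmetric Tψ₀ := fun α x ↦
    Kerr.fderiv_basisVector_zero_axialRotation (hΨ₀.differentiable
      (WithTop.coe_ne_zero.mpr ENat.top_ne_zero)) (fun β y ↦ Kerr.rotAverage_axialRotation G β y) α x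
  /- Step 4: the charge of the average -/
  have hΨc : ContinuousOn Ψ V := fun x hx ↦ (hΨV x hx).continuousAt.continuousWithinAt
  have hΨon : ContDiffOn ℝ 2 Ψ V := fun x hx ↦ ((hΨV x hx).of_le (WithTop.coe_le_coe.mpr le_top)).contDiffWithinAt
  have hLc : ContinuousOn (fderiv ℝ Ψ) V := hΨon.continuousOn_fderiv_of_isOpen hV (by norm_num)
  have hPV : ∀ σ θ φ, 0 ≤ σ → Kerr.horizonPoint M σ θ φ ∈ V := by
    intro σ θ φ hσ
    refine hK'V ⟨?_, ?_⟩
    · show Kerr.rPlus M M ≤ Kerr.radius M (Kerr.horizonPoint M σ θ φ)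
      rw [Kerr.rPlus_self, Kerr.radius_horizonPoint hM.le]
    · show 0 ≤ Kerr.horizonPoint M σ θ φ 0
      rwa [Kerr.horizonPoint_apply_zero]
  have hPN : ∀ σ θ φ, 0 ≤ σ → Kerr.horizonPoint M σ θ φ ∈ N := by
    intro σ θ φ hσ
    refine hKN ⟨?_, ?_⟩
    · show Kerr.rPlus M M ≤ Kerr.radius M (Kerr.horizonPoint M σ θ φ)
      rw [Kerr.rPlus_self, Kerr.radius_horizonPoint hM.le]
    · show 0 ≤ Kerr.horizonPoint M σ θ φ 0
      rwa [Kerr.horizonPoint_apply_zero]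
  have hdens₀ : ∀ θ φ, Kerr.densityFun M Ψ₀ 0 θ φ =
      ∫ α in (0 : ℝ)..2 * Real.pi, Kerr.densityFun M Ψ 0 θ (φ + α) := by
    intro θ φ
    have hP0 : Continuous fun β : ℝ ↦ Kerr.horizonPoint M 0 θ β := by
      simp only [Kerr.horizonPoint_eq_toLp]
      refine Kerr.continuous_toLp_four ?_ ?_ ?_ ?_ <;> fun_prop
    have hP0V : ∀ β, Kerr.horizonPoint M 0 θ β ∈ V := fun β ↦ hPV 0 θ β le_rfl
    have hN0 : Continuous fun β : ℝ ↦ Kerr.horizonNull θ β := by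
      simp only [Kerr.horizonNull]
      refine Kerr.continuous_toLp_four ?_ ?_ ?_ ?_ <;> fun_prop
    exact Kerr.densityFun_rotAverage hM hG hN hGN (fun α ↦ hPN 0 θ (φ + α) le_rfl)
      (hΨc.comp_continuous hP0 hP0V)
      ((hLc.comp_continuous hP0 hP0V).clm_apply continuous_const)
      ((hLc.comp_continuous hP0 hP0V).clm_apply hN0)
  have hH₀ : aretakisCharge M r₀ ψ₀ = 2 * Real.pi * aretakisCharge M r₀ ψ := by
    rw [Kerr.aretakisCharge_of_rep hM hr₀M Ψ₀, Kerr.aretakisCharge_eq_sphereIntegral_densityFun ψ]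
    refine Kerr.sphereIntegral_of_orbitIntegral hdens₀ ?_ fun θ φ ↦ Kerr.densityFun_add_two_pi M Ψ 0 θ φ
    exact Kerr.continuous_densityFun_angles hM hΨc hLc hPV le_rfl
  have hH₀ne : aretakisCharge M r₀ ψ₀ ≠ 0 := by
    rw [hH₀]; exact mul_ne_zero (by positivity) hH
  set A : ℝ := |aretakisCharge M r₀ ψ₀| with hAdef
  have hA : 0 < A := abs_pos.mpr hH₀ne
  have hAψ : A = 2 * Real.pi * |aretakisCharge M r₀ ψ| := by
    rw [hAdef, hH₀, abs_mul, abs_of_pos (by positivity)]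
  /- Step 5: apply the facts -/
  set ε : ℝ := A / (32 * Real.pi * M ^ 2 * (M + 2)) with hεdef
  have hε : 0 < ε := by positivity
  obtain ⟨τψ, hτψ⟩ := hDec M hM r₀ ⟨hr₀pos, hr₀M⟩ U₀ ψ₀ hU₀ hKU₀ hψ₀ hsol₀ hloc₀ haxi₀ ε hε
  obtain ⟨τT, hτT⟩ := hDec M hM r₀ ⟨hr₀pos, hr₀M⟩ U₀ Tψ₀ hU₀ hKU₀ hTψ₀ hsolT hlocT haxiT ε hε
  obtain ⟨τB, hτB⟩ := hB U₀ ψ₀ hU₀ hKU₀ hψ₀ hsol₀ hloc₀ haxi₀ hH₀ne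
  refine ⟨max (max τψ τT) (max τB 0), fun τ hτ ↦ ?_⟩
  have hτψ' : τψ ≤ τ := le_trans (le_trans (le_max_left _ _) (le_max_left _ _)) hτ
  have hτT' : τT ≤ τ := le_trans (le_trans (le_max_right _ _) (le_max_left _ _)) hτ
  have hτB' : τB ≤ τ := le_trans (le_trans (le_max_left _ _) (le_max_right _ _)) hτ
  have hτ0 : 0 ≤ τ := le_trans (le_trans (le_max_right _ _) (le_max_right _ _)) hτ
  -- membership facts on `S_τ`
  have hSK : ∀ x ∈ Kerr.horizonSection M M r₀ τ, x ∈ U₀ := fun x hx ↦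
    hKU₀ ⟨hx.1.ge, by rw [hx.2]; exact hτ0⟩
  have hSrot : ∀ x ∈ Kerr.horizonSection M M r₀ τ, ∀ α,
      Kerr.axialRotate M r₀ α x ∈ Kerr.horizonSection M M r₀ τ := fun x hx α ↦
    Kerr.axialRotate_mem_horizonSection_iff.mpr hx
  -- the transversal derivatives of `ψ` along orbits, as continuous functions of the angle
  set YG : E4 → ℝ := fun w ↦ fderiv ℝ G w (Kerr.nullVector M w) with hYGdef
  have hYG : ContDiff ℝ ∞ YG := Kerr.contDiff_transversalFun hG hGsupp hVpos
  set YYG : E4 → ℝ := fun w ↦ fderiv ℝ YG w (Kerr.nullVector M w) with hYYGdef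
  have hYYG : ContDiff ℝ ∞ YYG := Kerr.contDiff_transversalFun hYG
    ((Kerr.tsupport_transversalFun_subset G).trans hGsupp) hVpos
  have hYorb : ∀ x ∈ U₀, ∀ α, Kerr.transversalDeriv M r₀ ψ (Kerr.axialRotate M r₀ α x) =
      YG (E4.axialRotation α x) := by
    intro x hx α
    obtain ⟨hz', h⟩ := Kerr.transversalDeriv_eq_of_cutoff hU hψ hN hNU hGN (hU₀N x hx α)
    exact h
  have hYYorb : ∀ x ∈ U₀, ∀ α, Kerr.transversalDeriv M r₀ (Kerr.transversalDeriv M r₀ ψ)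
      (Kerr.axialRotate M r₀ α x) = YYG (E4.axialRotation α x) := by
    intro x hx α
    obtain ⟨hz', h⟩ := Kerr.transversalDeriv_transversalDeriv_eq_of_cutoff hU hψ hN hNU hGN (hU₀N x hx α)
    exact h
  constructor
  · /- k = 1: non-decay -/
    by_contra hcon
    simp only [not_exists, not_and, not_le] at hcon
    -- so `|Yψ| < c₁ |H₀[ψ]|` on `S_τ`, hence `|Yψ₀| < c₁ A` on `S_τ`
    have hY₀lt : ∀ x ∈ Kerr.horizonSection M M r₀ τ, |Kerr.transversalDeriv M r₀ ψ₀ x| < c₁ * A := by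
      intro x hx
      rw [hψ₀def, hΨ₀def, Kerr.transversalDeriv_rotAverage_eq_orbitIntegral hU hψ hG hN hNU hGN x
        (hU₀N x (hSK x hx))]
      have hlt : ∀ α ∈ Icc (0 : ℝ) (2 * Real.pi),
          |Kerr.transversalDeriv M r₀ ψ (Kerr.axialRotate M r₀ α x)| < c₁ * |aretakisCharge M r₀ ψ| := by
        intro α _
        refine lt_of_lt_of_le (hcon _ (hSrot x hx α)) ?_
        exact mul_le_mul_of_nonneg_right (min_le_left _ _) (abs_nonneg _)
      have hcont : Continuous fun α ↦ Kerr.transversalDeriv M r₀ ψ (Kerr.axialRotate M r₀ α x) := by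
        simp only [hYorb x (hSK x hx)]
        exact hYG.continuous.comp (Kerr.continuous_axialRotation_apply (x : E4))
      have h := Kerr.abs_integral_lt_of_forall_abs_lt hcont hlt
      rw [hAψ]
      linarith
    -- the maximum `m` of `|Yψ₀|` over the sphere
    have hcY : Continuous fun q : ℝ × ℝ ↦ |fderiv ℝ Ψ₀ (Kerr.horizonPoint M τ q.1 q.2)
        (Kerr.horizonNull q.1 q.2)| := by
      have hN' : Continuous fun q : ℝ × ℝ ↦ Kerr.horizonNull q.1 q.2 := by
        simp only [Kerr.horizonNull]
        refine Kerr.continuous_toLp_four ?_ ?_ ?_ ?_ <;> fun_prop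
      have hB0 : Continuous fun q : ℝ × ℝ ↦ fderiv ℝ Ψ₀ (Kerr.horizonPoint M τ q.1 q.2) :=
        (hΨ₀.continuous_fderiv (WithTop.coe_ne_zero.mpr ENat.top_ne_zero)).comp
          (Kerr.continuous_horizonPoint_angles M τ)
      exact (hB0.clm_apply hN').abs
    obtain ⟨q₀, hq₀, hmax⟩ := ((isCompact_Icc (a := (0 : ℝ)) (b := Real.pi)).prod
      (isCompact_Icc (a := (0 : ℝ)) (b := 2 * Real.pi))).exists_isMaxOn
      ((nonempty_Icc.mpr hπ.le).prod (nonempty_Icc.mpr (by positivity))) hcY.continuousOn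
    set m : ℝ := |fderiv ℝ Ψ₀ (Kerr.horizonPoint M τ q₀.1 q₀.2) (Kerr.horizonNull q₀.1 q₀.2)| with hmdef
    -- the points of the parametrised sphere are in `S_τ`
    have hpS : ∀ θ φ, ∃ hp : Kerr.horizonPoint M τ θ φ ∈ Kerr.region M r₀,
        (⟨_, hp⟩ : Kerr.region M r₀) ∈ Kerr.horizonSection M M r₀ τ := fun θ φ ↦
      ⟨Kerr.horizonPoint_mem_region hM hr₀M τ θ φ,
        by rw [Kerr.mem_horizonSection]; exact ⟨by rw [Kerr.rPlus_self]; exact Kerr.radius_horizonPoint hM.le τ θ φ,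
          Kerr.horizonPoint_apply_zero M τ θ φ⟩⟩
    have hYrep : ∀ θ φ, fderiv ℝ Ψ₀ (Kerr.horizonPoint M τ θ φ) (Kerr.horizonNull θ φ) =
        Kerr.transversalDeriv M r₀ ψ₀ ⟨_, (hpS θ φ).1⟩ := by
      intro θ φ
      rw [Kerr.transversalDeriv_of_rep (hΨ₀.differentiable (WithTop.coe_ne_zero.mpr ENat.top_ne_zero)),
        Kerr.nullVector_horizonPoint hM]
    have hm : m < c₁ * A := by
      rw [hmdef, hYrep]
      exact hY₀lt _ (hpS _ _).2
    -- pointwise bound of the density on the sphere `S_τ`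
    have hbound : ∀ θ ∈ Icc (0 : ℝ) Real.pi, ∀ φ ∈ Icc (0 : ℝ) (2 * Real.pi),
        |Kerr.densityFun M Ψ₀ τ θ φ| ≤ (2 * M ^ 2 * ((M + 2) * ε + 4 * M * m)) * Real.sin θ := by
      intro θ hθ φ hφ
      obtain ⟨hp, hpSτ⟩ := hpS θ φ
      have h0' := hτψ τ hτψ' ⟨Kerr.horizonPoint M τ θ φ, hp⟩ hpSτ
      have h0 : |Ψ₀ (Kerr.horizonPoint M τ θ φ)| ≤ ε := h0'
      have hT' := hτT τ hτT' ⟨Kerr.horizonPoint M τ θ φ, hp⟩ hpSτ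
      have hT : |fderiv ℝ Ψ₀ (Kerr.horizonPoint M τ θ φ) (E4.basisVector 0)| ≤ ε := hT'
      have hq : ((θ, φ) : ℝ × ℝ) ∈ Icc (0 : ℝ) Real.pi ×ˢ Icc (0 : ℝ) (2 * Real.pi) :=
        mem_prod.mpr ⟨hθ, hφ⟩
      have hY' := hmax hq
      have hY : |fderiv ℝ Ψ₀ (Kerr.horizonPoint M τ θ φ)
          (Kerr.nullVector M (Kerr.horizonPoint M τ θ φ))| ≤ m := by
        rw [Kerr.nullVector_horizonPoint hM τ θ φ]
        exact hY'
      exact Kerr.abs_densityFun_le hM hθ h0 hT hY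
    -- the estimate contradicts conservation
    have hcons : aretakisChargeAt M r₀ ψ₀ τ = aretakisCharge M r₀ ψ₀ :=
      Aretakis2015_chargeConservation_holds M hM r₀ ⟨hr₀pos, hr₀M⟩ U₀ ψ₀ hU₀ hKU₀ hψ₀ hsol₀ τ hτ0
    have hest := Kerr.abs_sphereIntegral_le hbound
    rw [← Kerr.aretakisChargeAt_of_rep hM hr₀M Ψ₀ τ] at hest
    have hAτ : A = |aretakisChargeAt M r₀ ψ₀ τ| := by rw [hAdef, hcons]
    rw [← hAτ] at hest
    -- `A ≤ 8πM²(M+2)ε + 32πM³ m = A/4 + 32πM³ m` and `32πM³ m < A/2`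
    have h1 : 4 * Real.pi * (2 * M ^ 2 * ((M + 2) * ε + 4 * M * m)) =
        A / 4 + 32 * Real.pi * M ^ 3 * m := by
      rw [hεdef]
      field_simp
      ring
    have h2 : 32 * Real.pi * M ^ 3 * m < A / 2 := by
      have h3 : 32 * Real.pi * M ^ 3 * (c₁ * A) = A / 2 := by
        rw [hc₁def]
        field_simp
        ring
      have h4 : 32 * Real.pi * M ^ 3 * m < 32 * Real.pi * M ^ 3 * (c₁ * A) :=
        mul_lt_mul_of_pos_left hm (by positivity)
      linarith
    linarith
  · /- k = 2: blow-up -/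
    obtain ⟨x, hxS, hxB⟩ := hτB τ hτB'
    -- `c₂ |H₀[ψ₀]| τ ≤ |YYψ₀ x| = |∫ YYψ ∘ R_α|`
    rw [hψ₀def, hΨ₀def, Kerr.transversalDeriv_transversalDeriv_rotAverage_eq_orbitIntegral hU hψ hG hGsupp
      hVpos hN hNU hGN x (hU₀N x (hSK x hxS))] at hxB
    by_cases hb : min c₁ c₂ * |aretakisCharge M r₀ ψ| * τ ≤ 0
    · exact ⟨x, hxS, hb.trans (abs_nonneg _)⟩
    · replace hb := not_le.mp hb
      have hcont : Continuous fun α ↦ Kerr.transversalDeriv M r₀ (Kerr.transversalDeriv M r₀ ψ)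
          (Kerr.axialRotate M r₀ α x) := by
        simp only [hYYorb x (hSK x hxS)]
        exact hYYG.continuous.comp (Kerr.continuous_axialRotation_apply (x : E4))
      have hmin : min c₁ c₂ * |aretakisCharge M r₀ ψ| * τ ≤ c₂ * |aretakisCharge M r₀ ψ| * τ :=
        mul_le_mul_of_nonneg_right (mul_le_mul_of_nonneg_right (min_le_right _ _) (abs_nonneg _)) hτ0
      have hb' : 0 < c₂ * |aretakisCharge M r₀ ψ| * τ := lt_of_lt_of_le hb hmin
      have hge : 2 * Real.pi * (c₂ * |aretakisCharge M r₀ ψ| * τ) ≤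
          |∫ α in (0 : ℝ)..2 * Real.pi, Kerr.transversalDeriv M r₀ (Kerr.transversalDeriv M r₀ ψ)
            (Kerr.axialRotate M r₀ α x)| := by
        have : c₂ * |aretakisCharge M r₀ ψ₀| * τ = 2 * Real.pi * (c₂ * |aretakisCharge M r₀ ψ| * τ) := by
          rw [← hAdef, hAψ]; ring
        rw [← this]
        exact hxB
      obtain ⟨α, -, hα⟩ := Kerr.exists_le_abs_of_le_abs_integral hcont hge
      exact ⟨Kerr.axialRotate M r₀ α x, hSrot x hxS α, le_trans hmin hα⟩

end Literature.Barriers.FinalStateConjecture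

end
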